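import Mathlib
import Summits.AtomisticToContinuum.FouriersLaw.Theses.EmbeddedDrudeMourre
import Summits.AtomisticToContinuum.FouriersLaw.Theorems.EmbeddedDrudeMourreDrudeDissolutionStubExcursionSecondDifferenceConcreteRegularity
import HarnessLib

/-!
# The gradient of a factorised resonance function `Ω = σ·A·S₁·S₂` in coordinates
# (stub B1b″ of line `kinetic-polymer-gas-on-the-time-axis`, infrastructure of the gradient floor (C4))
(crux `EmbeddedDrudeMourre.DrudeDissolution`, item stmt-AtomisticToContinuum-12593; `--supports` file, closes
nothing; lead c13)

WHAT. Cell order `p = (k₁,(k₃,k₂))`, `S₁ p = sin((p.2.1 − p.1)/2)`, `S₂ p = sin((p.2.1 − p.2.2)/2)` (half-angle sines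
of the distances to the two exchange planes). This file records the coordinate partials of `S₁, S₂`
(`fderiv_S1_apply`, `fderiv_S2_apply`) and, for any differentiable transversal coordinate `A` with
`Ω = σ·A·S₁·S₂` (sibling's `stub_resonanceFactorisation` in the twin's normalisation), the three coordinate partials
of `Ω` (`fderiv_factorised_apply`, registered):
`∂ⱼΩ = σ(S₁S₂·∂ⱼA + A·S₂·∂ⱼS₁ + A·S₁·∂ⱼS₂)`.
These feed the local Morse–Bott floors near the co-moving curves and the triple points.

HOW. The two half-angle maps are `sin ∘ (continuous linear)`, the product rule, evaluation of continuous linear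
maps on the coordinate basis.
-/

noncomputable section

open Set Real Topology
open Literature.MathematicalPhysics.KineticTheory
open Literature.MathematicalPhysics.KineticTheory.PhononBoltzmann

namespace Summit.AtomisticToContinuum.FouriersLaw.Theorems.DrudeDissolution.KineticPolymerGasOnTheTimeAxis

/-! ### The half-angle sines and their partials -/

/-- The Fréchet derivative of `S₁ p = sin((p.2.1 − p.1)/2)`. [folklore] -/
theorem hasFDerivAt_S1 (p : ℝ × ℝ × ℝ) :
    HasFDerivAt (fun q : ℝ × ℝ × ℝ => Real.sin ((q.2.1 - q.1) / 2))
      (Real.cos ((p.2.1 - p.1) / 2) • ((1 / 2 : ℝ) •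
        ((ContinuousLinearMap.fst ℝ ℝ ℝ).comp (ContinuousLinearMap.snd ℝ ℝ (ℝ × ℝ)) -
          ContinuousLinearMap.fst ℝ ℝ (ℝ × ℝ)))) p := by
  set L : ℝ × ℝ × ℝ →L[ℝ] ℝ := (1 / 2 : ℝ) •
    ((ContinuousLinearMap.fst ℝ ℝ ℝ).comp (ContinuousLinearMap.snd ℝ ℝ (ℝ × ℝ)) -
      ContinuousLinearMap.fst ℝ ℝ (ℝ × ℝ)) with hL
  have hLapp : ∀ q : ℝ × ℝ × ℝ, L q = (q.2.1 - q.1) / 2 := fun q => by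
    simp only [hL, smul_apply, sub_apply,
      ContinuousLinearMap.comp_apply, ContinuousLinearMap.coe_fst', ContinuousLinearMap.coe_snd', smul_eq_mul]
    ring
  have hfun : (fun q : ℝ × ℝ × ℝ => Real.sin ((q.2.1 - q.1) / 2)) = Real.sin ∘ L := by
    funext q; simp only [Function.comp_apply, hLapp]
  rw [hfun]
  have h := (Real.hasDerivAt_sin (L p)).comp_hasFDerivAt p L.hasFDerivAt
  rw [hLapp] at h
  exact h

/-- The Fréchet derivative of `S₂ p = sin((p.2.1 − p.2.2)/2)`. [folklore] -/
theorem hasFDerivAt_S2 (p : ℝ × ℝ × ℝ) :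
    HasFDerivAt (fun q : ℝ × ℝ × ℝ => Real.sin ((q.2.1 - q.2.2) / 2))
      (Real.cos ((p.2.1 - p.2.2) / 2) • ((1 / 2 : ℝ) •
        ((ContinuousLinearMap.fst ℝ ℝ ℝ).comp (ContinuousLinearMap.snd ℝ ℝ (ℝ × ℝ)) -
          (ContinuousLinearMap.snd ℝ ℝ ℝ).comp (ContinuousLinearMap.snd ℝ ℝ (ℝ × ℝ))))) p := by
  set L : ℝ × ℝ × ℝ →L[ℝ] ℝ := (1 / 2 : ℝ) •
    ((ContinuousLinearMap.fst ℝ ℝ ℝ).comp (ContinuousLinearMap.snd ℝ ℝ (ℝ × ℝ)) -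
      (ContinuousLinearMap.snd ℝ ℝ ℝ).comp (ContinuousLinearMap.snd ℝ ℝ (ℝ × ℝ))) with hL
  have hLapp : ∀ q : ℝ × ℝ × ℝ, L q = (q.2.1 - q.2.2) / 2 := fun q => by
    simp only [hL, smul_apply, sub_apply,
      ContinuousLinearMap.comp_apply, ContinuousLinearMap.coe_fst', ContinuousLinearMap.coe_snd', smul_eq_mul]
    ring
  have hfun : (fun q : ℝ × ℝ × ℝ => Real.sin ((q.2.1 - q.2.2) / 2)) = Real.sin ∘ L := by
    funext q; simp only [Function.comp_apply, hLapp]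
  rw [hfun]
  have h := (Real.hasDerivAt_sin (L p)).comp_hasFDerivAt p L.hasFDerivAt
  rw [hLapp] at h
  exact h

/-- The coordinate partials of `S₁`: `(−c₁/2, c₁/2, 0)`, `c₁ = cos((p.2.1 − p.1)/2)`. [folklore] -/
theorem fderiv_S1_apply (p : ℝ × ℝ × ℝ) :
    fderiv ℝ (fun q : ℝ × ℝ × ℝ => Real.sin ((q.2.1 - q.1) / 2)) p (1, 0, 0) = -(Real.cos ((p.2.1 - p.1) / 2) / 2) ∧
      fderiv ℝ (fun q : ℝ × ℝ × ℝ => Real.sin ((q.2.1 - q.1) / 2)) p (0, 1, 0) = Real.cos ((p.2.1 - p.1) / 2) / 2 ∧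
      fderiv ℝ (fun q : ℝ × ℝ × ℝ => Real.sin ((q.2.1 - q.1) / 2)) p (0, 0, 1) = 0 := by
  rw [(hasFDerivAt_S1 p).fderiv]
  simp only [smul_apply, sub_apply, ContinuousLinearMap.comp_apply, ContinuousLinearMap.coe_fst',
    ContinuousLinearMap.coe_snd', smul_eq_mul, mul_one, mul_zero, sub_zero, zero_sub, and_true]
  refine ⟨by ring, by ring⟩

/-- The coordinate partials of `S₂`: `(0, c₂/2, −c₂/2)`, `c₂ = cos((p.2.1 − p.2.2)/2)`. [folklore] -/
theorem fderiv_S2_apply (p : ℝ × ℝ × ℝ) :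
    fderiv ℝ (fun q : ℝ × ℝ × ℝ => Real.sin ((q.2.1 - q.2.2) / 2)) p (1, 0, 0) = 0 ∧
      fderiv ℝ (fun q : ℝ × ℝ × ℝ => Real.sin ((q.2.1 - q.2.2) / 2)) p (0, 1, 0) = Real.cos ((p.2.1 - p.2.2) / 2) / 2 ∧
      fderiv ℝ (fun q : ℝ × ℝ × ℝ => Real.sin ((q.2.1 - q.2.2) / 2)) p (0, 0, 1) = -(Real.cos ((p.2.1 - p.2.2) / 2) / 2) := by
  rw [(hasFDerivAt_S2 p).fderiv]
  simp only [smul_apply, sub_apply, ContinuousLinearMap.comp_apply, ContinuousLinearMap.coe_fst',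
    ContinuousLinearMap.coe_snd', smul_eq_mul, mul_one, mul_zero, sub_zero, zero_sub, true_and]
  refine ⟨by ring, by ring⟩

/-! ### The partials of a factorised resonance function -/

/-- **Registered sub-goal `fderiv_factorised_apply`: the coordinate partials of `Ω = σ·A·S₁·S₂`.** If
`Ω q = σ·A q·S₁ q·S₂ q` for all `q` with `A` differentiable at `p`, then for every direction `e`,
`fderiv Ω p e = σ(S₁S₂·fderiv A p e + A·S₂·fderiv S₁ p e + A·S₁·fderiv S₂ p e)`. [folklore] -/
theorem fderiv_factorised_apply :
    ∀ (Ω A : ℝ × ℝ × ℝ → ℝ) (σ : ℝ) (p e : ℝ × ℝ × ℝ), DifferentiableAt ℝ A p →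
      (∀ q, Ω q = σ * A q * Real.sin ((q.2.1 - q.1) / 2) * Real.sin ((q.2.1 - q.2.2) / 2)) →
      fderiv ℝ Ω p e = σ * (Real.sin ((p.2.1 - p.1) / 2) * Real.sin ((p.2.1 - p.2.2) / 2) * fderiv ℝ A p e +
        A p * Real.sin ((p.2.1 - p.2.2) / 2) *
          fderiv ℝ (fun q : ℝ × ℝ × ℝ => Real.sin ((q.2.1 - q.1) / 2)) p e +
        A p * Real.sin ((p.2.1 - p.1) / 2) *
          fderiv ℝ (fun q : ℝ × ℝ × ℝ => Real.sin ((q.2.1 - q.2.2) / 2)) p e) := by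
  intro Ω A σ p e hA hΩ
  have h1 := hasFDerivAt_S1 p
  have h2 := hasFDerivAt_S2 p
  have hAd : HasFDerivAt A (fderiv ℝ A p) p := hA.hasFDerivAt
  have hprod := ((hAd.const_mul σ).mul h1).mul h2
  have hΩeq : Ω = ((fun y => σ * A y) * fun q : ℝ × ℝ × ℝ => Real.sin ((q.2.1 - q.1) / 2)) *
      fun q : ℝ × ℝ × ℝ => Real.sin ((q.2.1 - q.2.2) / 2) := by
    funext q; simp only [Pi.mul_apply]; exact hΩ q
  rw [hΩeq, hprod.fderiv, h1.fderiv, h2.fderiv]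
  simp only [add_apply, smul_apply, smul_eq_mul, Pi.mul_apply]
  ring

end Summit.AtomisticToContinuum.FouriersLaw.Theorems.DrudeDissolution.KineticPolymerGasOnTheTimeAxis

end
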